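import Mathlib
import Summits.NavierStokesRegularity.NavierStokesRegularity.Theorems.EulerZoomLiouvillePowerGaugeEulerLiouvilleSelfSimilarSourceExclusion
import Summits.NavierStokesRegularity.NavierStokesRegularity.Theorems.EulerZoomLiouvillePowerGaugeEulerLiouvilleSelfSimilarAlphaLimit
import HarnessLib

/-!
# Rung C1 of the crux `EulerZoomLiouville.PowerGaugeEulerLiouville`: vorticity vanishes on every backward-invariant
# TUBE of weak stretching — rings and other non-isolated repelling stagnation sets of the similarity flow
# (route №10, item stmt-NavierStokesRegularity-19832; `--supports`)

Helper file (theorems only). Seat ns-typeII-p3 (cell ns-regularity-ideate §B, D-0081).  Generalisation of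
`…SelfSimilarSourceBall` (crux idea «hyperbolic-stagnation exclusion», evidence #41): the adapted ball around a
stagnation POINT is replaced by the sublevel set `T = {q < r²}` of any differentiable function `q` out of which the
similarity field `W = γy + V` points (`Dq[W] ≥ 0` on `T`) — e.g. the squared meridional distance to a RING of
stagnation points of an axisymmetric profile (CIV 2026 §4: off-axis fixed points of the meridional flow come in circles
and are exactly the case not covered by their Thm 4.6), or a tubular neighbourhood of any transversally repelling
stagnation curve.  On such a tube the rate argument of `…SelfSimilarSourceExclusion` applies verbatim:

* `sublevel_flow_neg_le` — **backward invariance of the tube** (first-exit argument: `t ↦ q(Φ_{−t}y)` does not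
  increase while inside);
* `curl_eq_zero_on_sublevelTube` — **THE TUBE THEOREM**: if `T = {q < r²}` is bounded, `Dq[W] ≥ 0` on `T`, and the
  adapted stretching of `DW` on `T` is at most `Λ' < 1 + γ` (`⟪G(γh + DV(z)h), h⟫ ≤ Λ'⟪Gh,h⟫`, `G` symmetric,
  `≥ g₀ > 0`), then `curl V ≡ 0` on `T`.  For a transversally repelling RING of zeros of `W` the tangential
  eigenvalue of `DW` is `0` and the two transverse ones sum to `tr DW = 3γ < 1 + γ` (`γ < ½`), so in the window a
  meridional-source ring kills the vorticity around it exactly as a point source does.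

WHAT THIS IS NOT: not NS, not E, not rung C1 — the tube data (`q`, `G`, `Λ'`) are hypotheses; constructing them
for a concrete ring is the user's (refuter's) job.  [folklore; cf. ConstantinIgnatovaVicol2026Putative §4.3–4.4]
-/

noncomputable section

-- flat `Theorems/<Route><Decl>…` files of one crux share the namespace of the crux (tree convention)
set_option linter.dupNamespace false

open MeasureTheory Set Filter Topology Metric Function InnerProductSpace
open scoped RealInnerProductSpace NNReal ContDiff

namespace Summit.NavierStokesRegularity.NavierStokesRegularity.Theorems.PowerGaugeEulerLiouville.Kelvin

open Literature.Analysis Literature.Analysis.FluidPDE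

variable {γ : ℝ} {V : EuclideanSpace ℝ (Fin 3) → EuclideanSpace ℝ (Fin 3)} {P : EuclideanSpace ℝ (Fin 3) → ℝ}

/-! ### Backward invariance of an outflow tube -/

/-- **Backward invariance of a sublevel tube.** If `q` is differentiable and `Dq(z)[W(z)] ≥ 0` whenever
`q z < r²` (`W = γy + V` points out of the level sets of `q` inside the tube), then for `y` with `q y < r²` and all
`t ≥ 0`: `q(Φ_{−t} y) ≤ q(y)`; in particular the backward orbit stays in the tube. [folklore] -/
theorem sublevel_flow_neg_le (hV : ContDiff ℝ ∞ V) {K : ℝ} (hK : ∀ y, ‖fderiv ℝ V y‖ ≤ K)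
    {q : EuclideanSpace ℝ (Fin 3) → ℝ} (hq : Differentiable ℝ q) {r : ℝ}
    (hout : ∀ z : EuclideanSpace ℝ (Fin 3), q z < r ^ 2 → 0 ≤ fderiv ℝ q z (selfSimilarTransport γ 0 V z))
    {y : EuclideanSpace ℝ (Fin 3)} (hy : q y < r ^ 2) {t : ℝ} (ht : 0 ≤ t) :
    q (ODE.evolutionMap (fun _ : ℝ => selfSimilarTransport γ 0 V) 0 (-t) y) ≤ q y := by
  set Y : ℝ → EuclideanSpace ℝ (Fin 3) := fun t =>
    ODE.evolutionMap (fun _ : ℝ => selfSimilarTransport γ 0 V) 0 (-t) y with hYdef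
  set ρ : ℝ → ℝ := fun t => q (Y t) with hρ
  have hY : ∀ t, HasDerivAt Y ((-1 : ℝ) • selfSimilarTransport γ 0 V (Y t)) t :=
    fun t => hasDerivAt_flow_neg (γ := γ) hV hK y t
  have hρ' : ∀ t, HasDerivAt ρ (fderiv ℝ q (Y t) ((-1 : ℝ) • selfSimilarTransport γ 0 V (Y t))) t :=
    fun t => (hq (Y t)).hasFDerivAt.comp_hasDerivAt t (hY t)
  have hρc : Continuous ρ := continuous_iff_continuousAt.2 fun t => (hρ' t).continuousAt
  have hρ0 : ρ 0 = q y := by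
    simp only [hρ, hYdef, neg_zero, ODE.evolutionMap_self]
  have hder_nonpos : ∀ t, ρ t < r ^ 2 →
      fderiv ℝ q (Y t) ((-1 : ℝ) • selfSimilarTransport γ 0 V (Y t)) ≤ 0 := by
    intro t hin
    rw [map_smul, smul_eq_mul]
    have := hout (Y t) hin
    linarith
  -- first-exit argument
  by_contra hcon
  push Not at hcon
  have hρ0r : ρ 0 < r ^ 2 := by rw [hρ0]; exact hy
  have hcon' : ρ 0 < ρ t := by rw [hρ0]; exact hcon
  set ε : ℝ := min ((ρ t - ρ 0) / 2) ((r ^ 2 - ρ 0) / 2) with hε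
  have hε0 : 0 < ε := lt_min (by linarith) (by linarith)
  have hε1 : ε ≤ (ρ t - ρ 0) / 2 := min_le_left _ _
  have hε2 : ε ≤ (r ^ 2 - ρ 0) / 2 := min_le_right _ _
  set T : Set ℝ := {τ | τ ∈ Icc 0 t ∧ ρ 0 + ε ≤ ρ τ} with hT
  have hTc : IsClosed T := by
    have : T = Icc 0 t ∩ {τ | ρ 0 + ε ≤ ρ τ} := by ext τ; simp [hT]
    rw [this]
    exact isClosed_Icc.inter (isClosed_le continuous_const hρc)
  have htT : t ∈ T := ⟨⟨ht, le_rfl⟩, by linarith⟩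
  have hTne : T.Nonempty := ⟨t, htT⟩
  have hTbdd : BddBelow T := ⟨0, fun τ hτ => hτ.1.1⟩
  have ht₁T : sInf T ∈ T := hTc.csInf_mem hTne hTbdd
  set t₁ := sInf T with ht₁
  have ht₁0 : 0 < t₁ := by
    rcases eq_or_lt_of_le ht₁T.1.1 with h0 | h0
    · exfalso
      have := ht₁T.2
      rw [← h0] at this
      linarith
    · exact h0
  have hbelow : ∀ τ ∈ Ico 0 t₁, ρ τ < ρ 0 + ε := by
    intro τ hτ
    by_contra hge
    push Not at hge
    have hτT : τ ∈ T := ⟨⟨hτ.1, (le_of_lt hτ.2).trans ht₁T.1.2⟩, hge⟩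
    exact absurd (csInf_le hTbdd hτT) (not_le.2 hτ.2)
  have hanti : AntitoneOn ρ (Icc 0 t₁) := by
    refine antitoneOn_of_hasDerivWithinAt_nonpos (convex_Icc 0 t₁) hρc.continuousOn
      (fun τ _ => (hρ' τ).hasDerivWithinAt) fun τ hτ => ?_
    rw [interior_Icc] at hτ
    have hin : ρ τ < r ^ 2 := by
      have := hbelow τ ⟨hτ.1.le, hτ.2⟩
      linarith
    exact hder_nonpos τ hin
  have h1 : ρ t₁ ≤ ρ 0 := hanti (left_mem_Icc.2 ht₁0.le) (right_mem_Icc.2 ht₁0.le) ht₁0.le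
  have h2 : ρ 0 + ε ≤ ρ t₁ := ht₁T.2
  linarith

/-! ### The tube theorem -/

/-- **VORTICITY VANISHES ON EVERY BACKWARD-INVARIANT TUBE OF WEAK STRETCHING** (`Λ' < 1 + γ`).  Let `(V, P)` be a
classical self-similar profile (`V` smooth, `‖DV‖ ≤ K`), `q` differentiable with bounded tube `T = {q < r²}` out of
which `W = γy + V` points (`Dq[W] ≥ 0` on `T`), and `G` a symmetric matrix with `⟪Gh,h⟫ ≥ g₀‖h‖²` such that the
adapted stretching of `DW = γI + DV` is at most `Λ'` on `T`.  Then `curl V ≡ 0` on `T`.  (Rings: `q` = squared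
distance to the ring in the meridional plane; for a transversally repelling ring the transverse eigenvalues of `DW`
sum to `3γ < 1+γ` in the window.) [cite: ConstantinIgnatovaVicol2026Putative, §4.3 Thm 4.4 and §4.4 (rings of
meridional fixed points: the case left open by Thm 4.6)] -/
theorem curl_eq_zero_on_sublevelTube (hV : ContDiff ℝ ∞ V) {K : ℝ} (hK : ∀ y, ‖fderiv ℝ V y‖ ≤ K)
    (hprof : IsSelfSimilarEulerProfile γ 0 V P)
    {G : EuclideanSpace ℝ (Fin 3) →L[ℝ] EuclideanSpace ℝ (Fin 3)}
    (hGsym : ∀ u v : EuclideanSpace ℝ (Fin 3), ⟪G u, v⟫ = ⟪u, G v⟫) {g₀ : ℝ} (hg₀ : 0 < g₀)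
    (hGpos : ∀ h : EuclideanSpace ℝ (Fin 3), g₀ * ‖h‖ ^ 2 ≤ ⟪G h, h⟫)
    {Λ' : ℝ} (hΛ : Λ' < 1 + γ) {q : EuclideanSpace ℝ (Fin 3) → ℝ} (hq : Differentiable ℝ q) {r : ℝ}
    (hbdd : Bornology.IsBounded {z : EuclideanSpace ℝ (Fin 3) | q z < r ^ 2})
    (hout : ∀ z : EuclideanSpace ℝ (Fin 3), q z < r ^ 2 → 0 ≤ fderiv ℝ q z (selfSimilarTransport γ 0 V z))
    (hstretch : ∀ z : EuclideanSpace ℝ (Fin 3), q z < r ^ 2 →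
      ∀ h : EuclideanSpace ℝ (Fin 3), ⟪G (γ • h + fderiv ℝ V z h), h⟫ ≤ Λ' * ⟪G h, h⟫) :
    ∀ y : EuclideanSpace ℝ (Fin 3), q y < r ^ 2 → curl V y = 0 := by
  intro y hy
  refine curl_eq_zero_of_backward_orbit_stretching_lt hV hK hprof hGsym hg₀ hGpos hΛ hbdd
    (fun z hz h => hstretch z hz h) (y := y) fun s hs => ?_
  have h1 := sublevel_flow_neg_le (γ := γ) hV hK hq hout hy (t := -s) (by linarith)
  rw [neg_neg] at h1
  exact lt_of_le_of_lt h1 hy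

end Summit.NavierStokesRegularity.NavierStokesRegularity.Theorems.PowerGaugeEulerLiouville.Kelvin

end
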